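import Summits.QuantumFields.BalabanUV.T4Continuum.Support.ColourCovariantLaplacian
import Summits.QuantumFields.BalabanUV.T4Continuum.Support.PerturbedLimitAnalytic

/-!
# T⁴ programme, spine node NE2 (U1a) — THE RESOLVENT ROUTE's STATIONS ON THE COLOUR LAYER `(sites × components) × colours`:
# rate, named limit, Lipschitz and HOLOMORPHY in the coupling for EVERY perturbation family of the lifted free tower `Δ_a ⊗ 1`
# (tier B of `t4/SKELETON-NE2-P1.md`, row B7 part 1: «ROOT B ⇐ ONE instance of `PerturbationLaws`», on the right index type)

NE2 formalisation swarm, leaf prover 08 (row B7 = assembly), file 1.  The composition §1 of the skeleton — «R(P) ⇐ one typed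
instance `PerturbationLaws (Δ_a) P (J) κ (C₂L^{−k})`» — is in the tree for the SCALAR-COLOUR King tower only
(`NE2PerturbedLayer.ne2Plus_resolvent_route`, `PerturbedLimitAnalytic.pertLim` / `differentiableOn_pertLim`: all typed over
`P : (k : ℕ) → Matrix (idx L M k) (idx L M k) ℂ`).  Bałaban's `Δ_a(U)` acts on `𝔤`-valued 1-forms, index `idx L M k × o`; there the
tree had only the RATE (generic `BackgroundResolventTower.towerLimitRate_perturbed`, used by `ColourCovariantLaplacian`).  This file
supplies every station on the colour layer, for an ARBITRARY family `P : (k : ℕ) → Matrix (idx L M k × o) (idx L M k × o) ℂ` with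
`PerturbationLaws (k ↦ Δ_a^{(k)} ⊗ 1) P (k ↦ J_k ⊗ 1) κ (k ↦ C₂L^{−k})` and every coupling `‖t‖κ < 1`:

 * §1 the lifted free data: **`freeTowerLaws_king_kron`** (`KroneckerLift.freeTowerLaws_kron` of `NE2PerturbedLayer.freeTowerLaws_king`),
   `‖(Δ_a^{(k)} ⊗ 1)⁻¹‖ ≤ Cst`;
 * §2 the colour unit-lattice covariances **`pertCovC P t k`** `= (L^d)^k·(Q^{(k)} ⊗ 1)(Δ_a^{(k)} ⊗ 1 + tP_k)⁻¹(Q^{(k)} ⊗ 1)ᴴ`: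
   **`towerLimitRate_perturbed_king_kron`** (rate `L^{−k}`, constant `Cpert κ (2dCst) CJ C₂ 0 t` — the SAME constants as the scalar
   layer, since the lift preserves every free defect), Lipschitz in `t` along the tower and in the limit (NE2-LIP);
 * §3 the NAMED limit **`pertLimC`**, uniform convergence on smaller discs and **`differentiableOn_pertLimC`**: `t ↦ c_∞(t)` is
   complex-differentiable on the Neumann disc `{‖t‖κ < 1}` (port of `PerturbedLimitAnalytic` §2–§4 to the colour index);
 * §4 **`ne2Plus_resolvent_route_kron`**: the conjunction by name (named limits at `t` and `0`, rate, NE2-LIP) — so that ROW B7's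
   ROOT B is LITERALLY «one instance `perturbationLaws_balaban`» — and, as the instance available today, row B2's NON-ABELIAN
   COVARIANT LAPLACIAN through every station (**`colourCovariantLaplacian_layer`**, from `perturbationLaws_colourCovariantLaplacian`).

HONEST FRAMING (T4-DAG p. 1).  [folklore] bookkeeping and standard complex analysis over finite matrices; the background enters as an
abstract perturbation family of the lifted free tower in a GLOBAL small gauge; finite torus, linear layer, operator norm; NOT [B9]
(3.23)–(3.26) as printed; NE2 NOT proved; NOT infinite volume / mass gap / Clay / summit progress; spine 0/9 unchanged.  HONEST
DEPENDENCY: continuum YM on T⁴ ⇐ BetaPertH ∧ nine spine estimates (0/9 proved); BetaPertH ⇐ (D1) ∧ (D4) ∧ CAP+tail; G-an2-4 gates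
asym, D1 and NE2/3/4.  ABSOLUTE RULE kept; no `sorry`.
-/

noncomputable section

open scoped BigOperators ComplexConjugate Matrix Matrix.Norms.L2Operator Kronecker
open Filter Topology

namespace Summit.QuantumFields.BalabanUV.T4Continuum.NE2ColourPerturbedLayer

open Literature.MathematicalPhysics.QuantumFieldTheory.Balaban1983to89.B5Prop11Plancherel (Cst Cst_nonneg)
open Summit.QuantumFields.BalabanUV.T4Continuum
open Summit.QuantumFields.BalabanUV.T4Continuum.CovariantAveragingTower (Atow avgTow TowerLimitRate)
open Summit.QuantumFields.BalabanUV.T4Continuum.BalabanAveragedTowerUnit (idx Qlev calGlev opNorm_Qlev_sq_le)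
open Summit.QuantumFields.BalabanUV.T4Continuum.BackgroundResolventLaw (isUnit_add_smul_right)
open Summit.QuantumFields.BalabanUV.T4Continuum.BackgroundResolventTower
open Summit.QuantumFields.BalabanUV.T4Continuum.KingPairingPlantedLaw
open Summit.QuantumFields.BalabanUV.T4Continuum.NE2PerturbedLayer
open Summit.QuantumFields.BalabanUV.T4Continuum.FirstOrderBackgroundModel
open Summit.QuantumFields.BalabanUV.T4Continuum.PerturbationAlgebra
open Summit.QuantumFields.BalabanUV.T4Continuum.KroneckerLift
open Summit.QuantumFields.BalabanUV.T4Continuum.ColourCovariantLaplacian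
open Summit.QuantumFields.BalabanUV.T4Continuum.PerturbedLimitAnalytic (Cpert_mono)

variable {d : ℕ} (L : ℕ) [NeZero L] (M : Fin d → ℕ) [hM : ∀ μ, NeZero (M μ)] (a : ℝ) (ha : 0 < a)
variable {o : Type*} [Fintype o] [DecidableEq o]

/-! ## §1 The lifted free data -/

/-- **`FreeTowerLaws` ON THE COLOUR LAYER — A THEOREM**: Bałaban's `Δ_a^{(k)} ⊗ 1`, King's averaging `Q_L ⊗ 1` and pairing `J_k ⊗ 1`
satisfy the `U = 1` tower laws with the SAME defects as the scalar-colour layer (`2d·Cst·L^{−k}`, `CJ·L^{−k}`, pairing defect `0 ⊗ 1`).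
[cite: Balaban1984PropagatorsI, (1.73) p.30, Prop. 1.1 (1.89) p.33; King1986, (2.10) p.653, p.664, Lemma 4.5 (4.38) p.674] [folklore] -/
theorem freeTowerLaws_king_kron (o : Type*) [Fintype o] [DecidableEq o] :
    FreeTowerLaws (fun k => calDalev L M a ha k ⊗ₖ (1 : Matrix o o ℂ)) (fun k => Qlev L M k ⊗ₖ (1 : Matrix o o ℂ))
      (fun k => JpcT L M k ⊗ₖ (1 : Matrix o o ℂ)) (fun k => (0 : Matrix (idx L M k) (idx L M k) ℂ) ⊗ₖ (1 : Matrix o o ℂ))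
      ((L : ℝ) ^ d) (fun k => 2 * d * Cst d a * ((L : ℝ)⁻¹) ^ k) (fun k => CJ d a * ((L : ℝ)⁻¹) ^ k) (fun _ => 0) :=
  freeTowerLaws_kron o (freeTowerLaws_king L M a ha)

/-- `Δ_a^{(k)} ⊗ 1` is invertible. [folklore] -/
theorem isUnit_det_calDalev_kron (k : ℕ) : IsUnit (calDalev L M a ha k ⊗ₖ (1 : Matrix o o ℂ)).det :=
  isUnit_det_kron o (isUnit_det_calDalev L M a ha k)

/-- `(Δ_a^{(k)} ⊗ 1)⁻¹ = 𝒢^{(k)} ⊗ 1`. [cite: Balaban1984PropagatorsI, (1.71) p.30] [folklore] -/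
theorem inv_calDalev_kron (k : ℕ) : (calDalev L M a ha k ⊗ₖ (1 : Matrix o o ℂ))⁻¹ = calGlev L M a ha k ⊗ₖ (1 : Matrix o o ℂ) := by
  rw [kron_inv, calDalev_inv]

/-- `‖(Δ_a^{(k)} ⊗ 1)⁻¹‖ ≤ Cst` — (1.89), order zero, lifted. [cite: Balaban1984PropagatorsI, Prop. 1.1 (1.89) p.33] [folklore] -/
theorem opNorm_inv_calDalev_kron_le (k : ℕ) : ‖(calDalev L M a ha k ⊗ₖ (1 : Matrix o o ℂ))⁻¹‖ ≤ Cst d a := by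
  rw [kron_inv]; exact opNorm_kron_le_of_le o (opNorm_inv_calDalev_le L M a ha k)

omit hM in
/-- `0 < L^d` for `L ≥ 1`. [folklore] -/
theorem pow_d_pos : (0 : ℝ) < (L : ℝ) ^ d := pow_pos (by exact_mod_cast Nat.pos_of_ne_zero (NeZero.ne L)) d

/-! ## §2 The perturbed colour tower: rate and Lipschitz continuity in the coupling -/

/-- **THE PERTURBED COLOUR UNIT-LATTICE COVARIANCE** at coupling `t`:
`c_k(t) = (L^d)^k·(Q^{(k)} ⊗ 1)(Δ_a^{(k)} ⊗ 1 + tP_k)⁻¹(Q^{(k)} ⊗ 1)ᴴ`.  For `P_k = Δ_a(U_k) − Δ_a ⊗ 1` and `t = 1` this is the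
King-averaged background propagator of `𝔤`-valued 1-forms read on the unit lattice. [folklore] -/
def pertCovC (P : (k : ℕ) → Matrix (idx L M k × o) (idx L M k × o) ℂ) (t : ℂ) (k : ℕ) : Matrix (idx L M 0 × o) (idx L M 0 × o) ℂ :=
  avgTow (fun k => Qlev L M k ⊗ₖ (1 : Matrix o o ℂ)) ((L : ℝ) ^ d)
    (fun k => (calDalev L M a ha k ⊗ₖ (1 : Matrix o o ℂ) + t • P k)⁻¹) k

/-- at `t = 0` the perturbed colour tower is the lifted `U = 1` tower `(L^d)^k·(Q^{(k)} ⊗ 1)(𝒢^{(k)} ⊗ 1)(Q^{(k)} ⊗ 1)ᴴ`. [folklore] -/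
theorem pertCovC_zero (P : (k : ℕ) → Matrix (idx L M k × o) (idx L M k × o) ℂ) (k : ℕ) :
    pertCovC L M a ha P 0 k
      = avgTow (fun k => Qlev L M k ⊗ₖ (1 : Matrix o o ℂ)) ((L : ℝ) ^ d) (fun k => calGlev L M a ha k ⊗ₖ (1 : Matrix o o ℂ)) k := by
  unfold pertCovC
  congr 1
  funext j
  rw [zero_smul, add_zero, inv_calDalev_kron]

/-- **NE2 ON THE COLOUR LAYER — THE TOWER LIMIT WITH RATE** (`L ≥ 2`): for every perturbation family `P_k` of the lifted free tower with
(H-bd) `‖P_k(𝒢^{(k)} ⊗ 1)‖, ‖(𝒢^{(k)} ⊗ 1)P_k‖ ≤ κ` and (H-cons) `‖(𝒢^{(k+1)} ⊗ 1)(P_{k+1}(J_k ⊗ 1) − (J_k ⊗ 1)P_k)(𝒢^{(k)} ⊗ 1)‖ ≤ C₂L^{−k}`,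
and every coupling `‖t‖κ < 1`, the colour unit-lattice covariances CONVERGE with `‖c_k(t) − c_∞(t)‖ ≤ Cpert(t)·L^{−k}/(1 − L^{−1})`,
`Cpert(t) = (CJ + ‖t‖C₂)(1 − ‖t‖κ)^{−2} + 2d·Cst·(1 − ‖t‖κ)^{−1}`.  Statement and constants OURS.
[cite: King1986, Lemma 4.5 (4.32)/(4.38) p.674 (scalar resolvent template); Balaban1984PropagatorsI, Prop. 1.1 (1.89) p.33;
Balaban1985BackgroundPropagators, (3.26) p.395 (where the background enters)] [folklore] -/
theorem towerLimitRate_perturbed_king_kron (hL : 2 ≤ L) {P : (k : ℕ) → Matrix (idx L M k × o) (idx L M k × o) ℂ} {κ C₂ : ℝ}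
    (hpert : PerturbationLaws (fun k => calDalev L M a ha k ⊗ₖ (1 : Matrix o o ℂ)) P (fun k => JpcT L M k ⊗ₖ (1 : Matrix o o ℂ)) κ
      (fun k => C₂ * ((L : ℝ)⁻¹) ^ k)) {t : ℂ} (ht : ‖t‖ * κ < 1) :
    TowerLimitRate (fun k => Qlev L M k ⊗ₖ (1 : Matrix o o ℂ)) ((L : ℝ) ^ d)
      (fun k => (calDalev L M a ha k ⊗ₖ (1 : Matrix o o ℂ) + t • P k)⁻¹) (Cpert κ (2 * d * Cst d a) (CJ d a) C₂ 0 t) ((L : ℝ)⁻¹) := by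
  have hL1 : (1 : ℝ) < L := by exact_mod_cast (lt_of_lt_of_le one_lt_two hL : 1 < L)
  refine towerLimitRate_perturbed (pow_d_pos (d := d) L) (freeTowerLaws_king_kron L M a ha o) hpert (inv_lt_one_of_one_lt₀ hL1)
    (fun k => le_rfl) (fun k => le_rfl) (fun k => le_rfl) (fun k => ?_) ht
  simp only [zero_mul, le_refl]

/-- the same, unfolded on `pertCovC`: existence of the limit and the explicit rate. [folklore] -/
theorem pertCovC_tendsto (hL : 2 ≤ L) {P : (k : ℕ) → Matrix (idx L M k × o) (idx L M k × o) ℂ} {κ C₂ : ℝ}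
    (hpert : PerturbationLaws (fun k => calDalev L M a ha k ⊗ₖ (1 : Matrix o o ℂ)) P (fun k => JpcT L M k ⊗ₖ (1 : Matrix o o ℂ)) κ
      (fun k => C₂ * ((L : ℝ)⁻¹) ^ k)) {t : ℂ} (ht : ‖t‖ * κ < 1) :
    ∃ cinf : Matrix (idx L M 0 × o) (idx L M 0 × o) ℂ, Tendsto (pertCovC L M a ha P t) atTop (𝓝 cinf) ∧
      ∀ k, ‖pertCovC L M a ha P t k - cinf‖ ≤ Cpert κ (2 * d * Cst d a) (CJ d a) C₂ 0 t * ((L : ℝ)⁻¹) ^ k / (1 - (L : ℝ)⁻¹) :=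
  towerLimitRate_perturbed_king_kron L M a ha hL hpert ht

/-- **LIPSCHITZ IN THE COUPLING ALONG THE COLOUR TOWER**: under (H-bd), `‖c_k(t) − c_k(0)‖ ≤ ‖t‖κ·Cst·(1 − ‖t‖κ)^{−1}` at every level.
[cite: Balaban1984PropagatorsI, Prop. 1.1 (1.89) p.33; Balaban1985BackgroundPropagators, Thm 3.4 p.400 (shape)] [folklore] -/
theorem pertCovC_sub_le {P : (k : ℕ) → Matrix (idx L M k × o) (idx L M k × o) ℂ} {κ : ℝ} {e₂ : ℕ → ℝ}
    (hpert : PerturbationLaws (fun k => calDalev L M a ha k ⊗ₖ (1 : Matrix o o ℂ)) P (fun k => JpcT L M k ⊗ₖ (1 : Matrix o o ℂ)) κ e₂)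
    {t : ℂ} (ht : ‖t‖ * κ < 1) (k : ℕ) :
    ‖pertCovC L M a ha P t k - pertCovC L M a ha P 0 k‖ ≤ ‖t‖ * κ * Cst d a * (1 - ‖t‖ * κ)⁻¹ := by
  have hγ : ∀ k, ‖(calDalev L M a ha k ⊗ₖ (1 : Matrix o o ℂ))⁻¹‖ ≤ ((Cst d a)⁻¹)⁻¹ := fun k => by
    rw [inv_inv]; exact opNorm_inv_calDalev_kron_le L M a ha k
  have h := opNorm_avgTow_perturbed_sub_le (pow_d_pos (d := d) L) (freeTowerLaws_king_kron L M a ha o).opNorm_A_sq_le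
    (isUnit_det_calDalev_kron L M a ha) hγ hpert.opNorm_P_mul_inv_le hpert.opNorm_inv_mul_P_le ht k
  have e0 : pertCovC L M a ha P 0 k = avgTow (fun k => Qlev L M k ⊗ₖ (1 : Matrix o o ℂ)) ((L : ℝ) ^ d)
      (fun k => (calDalev L M a ha k ⊗ₖ (1 : Matrix o o ℂ))⁻¹) k := by
    unfold pertCovC; congr 1; funext j; rw [zero_smul, add_zero]
  rw [e0]
  rw [inv_inv] at h
  exact h

/-- **… AND IN THE LIMIT** (NE2-LIP on the colour layer): if both towers converge, `‖c_∞(t) − c_∞(0)‖ ≤ ‖t‖κ·Cst·(1 − ‖t‖κ)^{−1}`. [folklore] -/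
theorem pertLimC_sub_le_of_tendsto {P : (k : ℕ) → Matrix (idx L M k × o) (idx L M k × o) ℂ} {κ : ℝ} {e₂ : ℕ → ℝ}
    (hpert : PerturbationLaws (fun k => calDalev L M a ha k ⊗ₖ (1 : Matrix o o ℂ)) P (fun k => JpcT L M k ⊗ₖ (1 : Matrix o o ℂ)) κ e₂)
    {t : ℂ} (ht : ‖t‖ * κ < 1) {ct c0 : Matrix (idx L M 0 × o) (idx L M 0 × o) ℂ}
    (hct : Tendsto (pertCovC L M a ha P t) atTop (𝓝 ct)) (hc0 : Tendsto (pertCovC L M a ha P 0) atTop (𝓝 c0)) :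
    ‖ct - c0‖ ≤ ‖t‖ * κ * Cst d a * (1 - ‖t‖ * κ)⁻¹ := by
  have hlim : Tendsto (fun k => pertCovC L M a ha P t k - pertCovC L M a ha P 0 k) atTop (𝓝 (ct - c0)) := hct.sub hc0
  have hn := (continuous_norm.tendsto _).comp hlim
  exact le_of_tendsto' hn fun k => pertCovC_sub_le L M a ha hpert ht k

/-! ## §3 The named limit, uniform convergence on smaller discs, holomorphy -/

/-- the η → 0 limit colour covariance at coupling `t` (`limUnder`; meaningful where the tower converges). [folklore] -/
def pertLimC (P : (k : ℕ) → Matrix (idx L M k × o) (idx L M k × o) ℂ) (t : ℂ) : Matrix (idx L M 0 × o) (idx L M 0 × o) ℂ :=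
  limUnder atTop (pertCovC L M a ha P t)

/-- on the Neumann disc the colour tower converges to `pertLimC`, with the rate bound. [folklore] -/
theorem tendsto_pertLimC (hL : 2 ≤ L) {P : (k : ℕ) → Matrix (idx L M k × o) (idx L M k × o) ℂ} {κ C₂ : ℝ}
    (hpert : PerturbationLaws (fun k => calDalev L M a ha k ⊗ₖ (1 : Matrix o o ℂ)) P (fun k => JpcT L M k ⊗ₖ (1 : Matrix o o ℂ)) κ
      (fun k => C₂ * ((L : ℝ)⁻¹) ^ k)) {t : ℂ} (ht : ‖t‖ * κ < 1) :
    Tendsto (pertCovC L M a ha P t) atTop (𝓝 (pertLimC L M a ha P t)) ∧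
      ∀ k, ‖pertCovC L M a ha P t k - pertLimC L M a ha P t‖
        ≤ Cpert κ (2 * d * Cst d a) (CJ d a) C₂ 0 t * ((L : ℝ)⁻¹) ^ k / (1 - (L : ℝ)⁻¹) := by
  obtain ⟨c, hc, hrate⟩ := pertCovC_tendsto L M a ha hL hpert ht
  have hlim : Tendsto (pertCovC L M a ha P t) atTop (𝓝 (pertLimC L M a ha P t)) := tendsto_nhds_limUnder ⟨c, hc⟩
  have heq : pertLimC L M a ha P t = c := tendsto_nhds_unique hlim hc
  refine ⟨hlim, fun k => ?_⟩
  rw [heq]; exact hrate k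

/-- **NE2-LIP FOR THE NAMED LIMIT**: `‖c_∞(t) − c_∞(0)‖ ≤ ‖t‖κ·Cst·(1 − ‖t‖κ)^{−1}`. [folklore] -/
theorem pertLimC_sub_pertLimC_zero_le (hL : 2 ≤ L) {P : (k : ℕ) → Matrix (idx L M k × o) (idx L M k × o) ℂ} {κ C₂ : ℝ}
    (hpert : PerturbationLaws (fun k => calDalev L M a ha k ⊗ₖ (1 : Matrix o o ℂ)) P (fun k => JpcT L M k ⊗ₖ (1 : Matrix o o ℂ)) κ
      (fun k => C₂ * ((L : ℝ)⁻¹) ^ k)) {t : ℂ} (ht : ‖t‖ * κ < 1) :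
    ‖pertLimC L M a ha P t - pertLimC L M a ha P 0‖ ≤ ‖t‖ * κ * Cst d a * (1 - ‖t‖ * κ)⁻¹ := by
  have h0 : ‖(0 : ℂ)‖ * κ < 1 := by rw [norm_zero, zero_mul]; exact zero_lt_one
  exact pertLimC_sub_le_of_tendsto L M a ha hpert ht (tendsto_pertLimC L M a ha hL hpert ht).1
    (tendsto_pertLimC L M a ha hL hpert h0).1

/-- the fixed colour sandwich `X ↦ (L^d)^k·(Q^{(k)} ⊗ 1) X (Q^{(k)} ⊗ 1)ᴴ` as a linear map. [folklore] -/
def sandwichLMC (o : Type*) [Fintype o] [DecidableEq o] (k : ℕ) :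
    Matrix (idx L M k × o) (idx L M k × o) ℂ →ₗ[ℂ] Matrix (idx L M 0 × o) (idx L M 0 × o) ℂ where
  toFun X := ((((L : ℝ) ^ d : ℝ) : ℂ) ^ k) •
    (Atow (fun k => Qlev L M k ⊗ₖ (1 : Matrix o o ℂ)) k * X * (Atow (fun k => Qlev L M k ⊗ₖ (1 : Matrix o o ℂ)) k)ᴴ)
  map_add' X Y := by rw [Matrix.mul_add, Matrix.add_mul, smul_add]
  map_smul' c X := by rw [Matrix.mul_smul, Matrix.smul_mul, smul_comm, RingHom.id_apply]

/-- `c_k(t)` is the colour sandwich of the ring inverse of `Δ_a^{(k)} ⊗ 1 + tP_k`. [folklore] -/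
theorem pertCovC_eq_sandwich_inverse {P : (k : ℕ) → Matrix (idx L M k × o) (idx L M k × o) ℂ} (t : ℂ) (k : ℕ) :
    pertCovC L M a ha P t k = sandwichLMC L M o k (Ring.inverse (calDalev L M a ha k ⊗ₖ (1 : Matrix o o ℂ) + t • P k)) := by
  rw [← Matrix.nonsing_inv_eq_ringInverse]
  rfl

/-- **`t ↦ c_k(t)` IS DIFFERENTIABLE at every coupling with `‖t‖κ < 1`** (`Δ_a^{(k)} ⊗ 1 + tP_k` is a unit there). [folklore] -/
theorem differentiableAt_pertCovC {P : (k : ℕ) → Matrix (idx L M k × o) (idx L M k × o) ℂ} {κ : ℝ} {e₂ : ℕ → ℝ}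
    (hpert : PerturbationLaws (fun k => calDalev L M a ha k ⊗ₖ (1 : Matrix o o ℂ)) P (fun k => JpcT L M k ⊗ₖ (1 : Matrix o o ℂ)) κ e₂)
    (k : ℕ) {t : ℂ} (ht : ‖t‖ * κ < 1) :
    DifferentiableAt ℂ (fun s : ℂ => pertCovC L M a ha P s k) t := by
  have hfun : (fun s : ℂ => pertCovC L M a ha P s k)
      = (sandwichLMC L M o k).toContinuousLinearMap ∘
          (fun s : ℂ => Ring.inverse (calDalev L M a ha k ⊗ₖ (1 : Matrix o o ℂ) + s • P k)) := by
    funext s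
    rw [Function.comp_apply, LinearMap.coe_toContinuousLinearMap', pertCovC_eq_sandwich_inverse]
  rw [hfun]
  refine ((sandwichLMC L M o k).toContinuousLinearMap.differentiableAt).comp t ?_
  have hU : IsUnit (calDalev L M a ha k ⊗ₖ (1 : Matrix o o ℂ) + t • P k) :=
    isUnit_add_smul_right (isUnit_det_calDalev_kron L M a ha k) (hpert.opNorm_P_mul_inv_le k) ht
  have hlin : DifferentiableAt ℂ (fun s : ℂ => calDalev L M a ha k ⊗ₖ (1 : Matrix o o ℂ) + s • P k) t :=
    (differentiableAt_const _).add (differentiableAt_id.smul_const _)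
  exact hlin.inverse hU

/-- the constants are nonnegative. [folklore] -/
theorem consts_nonneg {P : (k : ℕ) → Matrix (idx L M k × o) (idx L M k × o) ℂ} {κ C₂ : ℝ}
    (hpert : PerturbationLaws (fun k => calDalev L M a ha k ⊗ₖ (1 : Matrix o o ℂ)) P (fun k => JpcT L M k ⊗ₖ (1 : Matrix o o ℂ)) κ
      (fun k => C₂ * ((L : ℝ)⁻¹) ^ k)) :
    0 ≤ κ ∧ 0 ≤ C₂ := by
  refine ⟨(norm_nonneg _).trans (hpert.opNorm_P_mul_inv_le 0), ?_⟩
  have h := (norm_nonneg _).trans (hpert.consistent_le 0)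
  simpa using h

/-- **UNIFORM CONVERGENCE ON SMALLER DISCS**: on `{‖t‖ < τ}` with `τκ < 1`, `c_k → c_∞` uniformly. [folklore] -/
theorem tendstoUniformlyOn_pertCovC (hL : 2 ≤ L) {P : (k : ℕ) → Matrix (idx L M k × o) (idx L M k × o) ℂ} {κ C₂ : ℝ}
    (hpert : PerturbationLaws (fun k => calDalev L M a ha k ⊗ₖ (1 : Matrix o o ℂ)) P (fun k => JpcT L M k ⊗ₖ (1 : Matrix o o ℂ)) κ
      (fun k => C₂ * ((L : ℝ)⁻¹) ^ k)) {τ : ℝ} (hτ : τ * κ < 1) :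
    TendstoUniformlyOn (fun k t => pertCovC L M a ha P t k) (pertLimC L M a ha P) atTop {t : ℂ | ‖t‖ < τ} := by
  obtain ⟨hκ, hC₂⟩ := consts_nonneg L M a ha hpert
  have hL1 : (1 : ℝ) < L := by exact_mod_cast (lt_of_lt_of_le one_lt_two hL : 1 < L)
  have hρ0 : (0 : ℝ) ≤ (L : ℝ)⁻¹ := inv_nonneg.mpr (Nat.cast_nonneg _)
  have hρ1 : (L : ℝ)⁻¹ < 1 := inv_lt_one_of_one_lt₀ hL1
  set B : ℝ := ((CJ d a + τ * C₂) * ((1 - τ * κ)⁻¹) ^ 2 + (2 * d * Cst d a + 2 * 0) * (1 - τ * κ)⁻¹) / (1 - (L : ℝ)⁻¹)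
    with hB
  have hbound : ∀ t : ℂ, ‖t‖ < τ → ∀ k, ‖pertCovC L M a ha P t k - pertLimC L M a ha P t‖ ≤ B * ((L : ℝ)⁻¹) ^ k := by
    intro t htτ k
    have ht : ‖t‖ * κ < 1 := lt_of_le_of_lt (mul_le_mul_of_nonneg_right htτ.le hκ) hτ
    have h1 := (tendsto_pertLimC L M a ha hL hpert ht).2 k
    have h2 := Cpert_mono (d := d) a hκ hC₂ htτ.le hτ
    have hden : 0 < 1 - (L : ℝ)⁻¹ := sub_pos.mpr hρ1
    refine h1.trans ?_
    rw [hB, div_mul_eq_mul_div]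
    exact div_le_div_of_nonneg_right (mul_le_mul_of_nonneg_right h2 (pow_nonneg hρ0 k)) hden.le
  have hgeo : Tendsto (fun k : ℕ => B * ((L : ℝ)⁻¹) ^ k) atTop (𝓝 0) := by
    have := (tendsto_pow_atTop_nhds_zero_of_lt_one hρ0 hρ1).const_mul B
    simpa using this
  rw [Metric.tendstoUniformlyOn_iff]
  intro ε hε
  have hev : ∀ᶠ k in atTop, B * ((L : ℝ)⁻¹) ^ k < ε := hgeo.eventually (gt_mem_nhds hε)
  filter_upwards [hev] with k hk t htτ
  rw [dist_comm, dist_eq_norm]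
  exact lt_of_le_of_lt (hbound t htτ k) hk

/-- **THE COLOUR LIMIT COVARIANCE IS HOLOMORPHIC IN THE COUPLING** (`L ≥ 2`): `t ↦ c_∞(t)` is complex-differentiable on the open
Neumann disc `{‖t‖κ < 1}` (all of `ℂ` if `κ = 0`); hence Cauchy estimates for the background dependence on every smaller disc. [folklore] -/
theorem differentiableOn_pertLimC (hL : 2 ≤ L) {P : (k : ℕ) → Matrix (idx L M k × o) (idx L M k × o) ℂ} {κ C₂ : ℝ}
    (hpert : PerturbationLaws (fun k => calDalev L M a ha k ⊗ₖ (1 : Matrix o o ℂ)) P (fun k => JpcT L M k ⊗ₖ (1 : Matrix o o ℂ)) κ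
      (fun k => C₂ * ((L : ℝ)⁻¹) ^ k)) :
    DifferentiableOn ℂ (pertLimC L M a ha P) {t : ℂ | ‖t‖ * κ < 1} := by
  obtain ⟨hκ, -⟩ := consts_nonneg L M a ha hpert
  intro t₀ ht₀
  have ht₀' : ‖t₀‖ * κ < 1 := ht₀
  obtain ⟨τ, hτt, hτ⟩ : ∃ τ : ℝ, ‖t₀‖ < τ ∧ τ * κ < 1 := by
    rcases eq_or_lt_of_le hκ with h0 | hpos
    · exact ⟨‖t₀‖ + 1, by linarith, by rw [← h0, mul_zero]; exact zero_lt_one⟩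
    · have h1 : ‖t₀‖ < κ⁻¹ := by rw [← one_div]; exact (lt_div_iff₀ hpos).mpr ht₀'
      refine ⟨(‖t₀‖ + κ⁻¹) / 2, by linarith, ?_⟩
      have e : (‖t₀‖ + κ⁻¹) / 2 * κ = (‖t₀‖ * κ + 1) / 2 := by field_simp
      rw [e]; linarith
  set V : Set ℂ := {t : ℂ | ‖t‖ < τ} with hV
  have hVopen : IsOpen V := isOpen_lt continuous_norm continuous_const
  have ht₀V : t₀ ∈ V := hτt
  have hunif := tendstoUniformlyOn_pertCovC L M a ha hL hpert hτ
  have hdiff : ∀ᶠ k in atTop, DifferentiableOn ℂ (fun t => pertCovC L M a ha P t k) V :=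
    Eventually.of_forall fun k => fun t htV =>
      (differentiableAt_pertCovC L M a ha hpert k
        (lt_of_le_of_lt (mul_le_mul_of_nonneg_right (le_of_lt htV) hκ) hτ)).differentiableWithinAt
  have hD : DifferentiableOn ℂ (pertLimC L M a ha P) V := hunif.tendstoLocallyUniformlyOn.differentiableOn hdiff hVopen
  exact (hD.differentiableAt (hVopen.mem_nhds ht₀V)).differentiableWithinAt

/-! ## §4 The conjunction by name, and the instance available today (row B2) -/

/-- **ROOT B ⇐ ONE INSTANCE, ON THE COLOUR LAYER** (`L ≥ 2`): for every perturbation family `P` of the lifted free tower with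
`PerturbationLaws (Δ_a ⊗ 1) P (J ⊗ 1) κ (C₂L^{−k})` and every `‖t‖κ < 1`: the NAMED η → 0 limits `c_∞(t)`, `c_∞(0)` of the King-averaged
colour covariances exist, with rate `‖c_k(t) − c_∞(t)‖ ≤ Cpert(t)·L^{−k}/(1 − L^{−1})`, NE2-LIP `‖c_∞(t) − c_∞(0)‖ ≤ ‖t‖κ·Cst·(1 − ‖t‖κ)^{−1}`,
and `c_∞` HOLOMORPHIC on the Neumann disc.  What remains of tier B is EXACTLY one such instance for Bałaban's `Δ_a(U_k) − Δ_a ⊗ 1`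
(rows B3–B6 of the skeleton, assembled in row B7 part 2). [folklore] -/
theorem ne2Plus_resolvent_route_kron (hL : 2 ≤ L) {P : (k : ℕ) → Matrix (idx L M k × o) (idx L M k × o) ℂ} {κ C₂ : ℝ}
    (hpert : PerturbationLaws (fun k => calDalev L M a ha k ⊗ₖ (1 : Matrix o o ℂ)) P (fun k => JpcT L M k ⊗ₖ (1 : Matrix o o ℂ)) κ
      (fun k => C₂ * ((L : ℝ)⁻¹) ^ k)) {t : ℂ} (ht : ‖t‖ * κ < 1) :
    Tendsto (pertCovC L M a ha P t) atTop (𝓝 (pertLimC L M a ha P t)) ∧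
      Tendsto (pertCovC L M a ha P 0) atTop (𝓝 (pertLimC L M a ha P 0)) ∧
      (∀ k, ‖pertCovC L M a ha P t k - pertLimC L M a ha P t‖
          ≤ Cpert κ (2 * d * Cst d a) (CJ d a) C₂ 0 t * ((L : ℝ)⁻¹) ^ k / (1 - (L : ℝ)⁻¹)) ∧
      ‖pertLimC L M a ha P t - pertLimC L M a ha P 0‖ ≤ ‖t‖ * κ * Cst d a * (1 - ‖t‖ * κ)⁻¹ ∧
      DifferentiableOn ℂ (pertLimC L M a ha P) {t : ℂ | ‖t‖ * κ < 1} := by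
  have h0 : ‖(0 : ℂ)‖ * κ < 1 := by rw [norm_zero, zero_mul]; exact zero_lt_one
  exact ⟨(tendsto_pertLimC L M a ha hL hpert ht).1, (tendsto_pertLimC L M a ha hL hpert h0).1,
    (tendsto_pertLimC L M a ha hL hpert ht).2, pertLimC_sub_pertLimC_zero_le L M a ha hL hpert ht,
    differentiableOn_pertLimC L M a ha hL hpert⟩

/-- **ROW B2 THROUGH EVERY STATION** (`L ≥ 2`, `d ≥ 1`): the NON-ABELIAN covariant-Laplacian coupling
`Δ_a ⊗ 1 + t(Δ^{R_k} − Δ^1 ⊗ 1)` (`ColourCovariantLaplacian.covPertC`), for colour transporters whose connection entries are a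
`LipschitzBackground (α, β)` and whose zeroth-order entries are a `BoundedBackground (α′, β′)`, and every `‖t‖κ_col < 1`: named limit
with rate `L^{−k}`, NE2-LIP, holomorphy on the Neumann disc. [folklore] -/
theorem colourCovariantLaplacian_layer (hL : 2 ≤ L) (hd : 1 ≤ d) {R : (k : ℕ) → Fin d → (idx L M k → Matrix o o ℂ)}
    {α β α' β' : ℝ} (hV : ∀ p : o × o, LipschitzBackground L M (Vab L M R p) α β)
    (hz : ∀ p : o × o, BoundedBackground L M (Zab L M R p) α' β') {t : ℂ} (ht : ‖t‖ * kappaCol o d a α β α' < 1) :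
    Tendsto (pertCovC L M a ha (covPertC L M R) t) atTop (𝓝 (pertLimC L M a ha (covPertC L M R) t)) ∧
      Tendsto (pertCovC L M a ha (covPertC L M R) 0) atTop (𝓝 (pertLimC L M a ha (covPertC L M R) 0)) ∧
      (∀ k, ‖pertCovC L M a ha (covPertC L M R) t k - pertLimC L M a ha (covPertC L M R) t‖
          ≤ Cpert (kappaCol o d a α β α') (2 * d * Cst d a) (CJ d a) (C2col o d L a α β β') 0 t * ((L : ℝ)⁻¹) ^ k
              / (1 - (L : ℝ)⁻¹)) ∧
      ‖pertLimC L M a ha (covPertC L M R) t - pertLimC L M a ha (covPertC L M R) 0‖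
          ≤ ‖t‖ * kappaCol o d a α β α' * Cst d a * (1 - ‖t‖ * kappaCol o d a α β α')⁻¹ ∧
      DifferentiableOn ℂ (pertLimC L M a ha (covPertC L M R)) {t : ℂ | ‖t‖ * kappaCol o d a α β α' < 1} :=
  ne2Plus_resolvent_route_kron L M a ha hL (perturbationLaws_colourCovariantLaplacian L M a ha hd hV hz) ht

end Summit.QuantumFields.BalabanUV.T4Continuum.NE2ColourPerturbedLayer

end
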